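import Mathlib.Tactic.Linarith
import Mathlib.Tactic.NormNum
import Mathlib.Tactic.Ring
import Mathlib.Algebra.BigOperators.Group.Finset.Basic
import Mathlib.Algebra.Ring.Commute
import HarnessLib

/-!
# The (0,1) cell of the ι-window, XLI: the product ground `B₁ × B₂`, XXVIII — THE CORNER XIII (report [XLI] `H2-ZERO-ONE-41.md`):
# arithmetic shadow of PROPOSITION GRAPH-THICK (global), LEMMA THICK-PAIRING, THEOREM THICK-SOCLE / COROLLARY FLAT,
# LEMMA S-TRACE / P-TRACE / TOP, LEMMA TRACELESS-THICK, and PROPOSITION PROFILE (the counting census does not close the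
# balanced thick line)

Family `hodge`, b2b cell `hweil` (helper of item stmt-HodgeConjecture-2524). Report
`run/shared/lean/b2b/hodge-weil/b2b-hweil-pv1-g53/H2-ZERO-ONE-41.md` ([XLI]). Context (the report's words, nothing of them formalised here): a
BALANCED thick two-block S-line `Y` of multiplicity `m = 2b` has `π_*𝒪_Y = 𝒪_{bΘ}[t̄]`, `t̄² = Ψt̄ + Φ`; its x̃-layers come in pairs (1-part degrees
`ℓ′_j`, t̄-part degrees `ℓ″_j`, `0 ≤ j < b`) with `ℓ′_0 = ℓ″_0 = 0`, `ℓ′_1 = −2`; the Gorenstein pairing of `ω_Y = I_T·Ω|_Y ⊂ Ω|_Y` is CROSSWISE and gives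
`ℓ′_j + ℓ″_{b−1−j} = 10 + c_j` with `c_j ≥ 0`, `Σ c_j = τ/2`; the invariant-socle feed reads `Σ_{i=2}^{j} (10 − ℓ′_i − ℓ″_i + L_i) ≤ ε₀`. The theorems below
are the integer arithmetic of those statements and of the explicit profile that satisfies all of them. They claim no geometry. HONEST FRAMING: census work
inside the ladder's H2 test ((0,1) cell) on the SPECIAL fourfold `X₀`; nothing here is a rung; no case of the Hodge conjecture is proved; no statement of
[Markman 2025] / [Perry 2026] / [EdGFS 2025] is used.
-/

-- mandated namespace `Summit.HodgeConjecture.HodgeConjecture.…` (Problem = Summit) trips `linter.dupNamespace`; the lakefile disables it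
-- tree-wide (weak option), restated here so stand-alone elaboration is warning-free too.
set_option linter.dupNamespace false

open Finset

namespace Summit.HodgeConjecture.HodgeConjecture.WeilTypeLadder

section ProductGroundTwentyEight

/-- **[XLI] 3.1 (LEMMA THICK-PAIRING, consequences).** With the pairing `ℓ′_j + ℓ″_k = 10 + c_j` for `j + k + 1 = b`, the normalisations
`ℓ′_0 = ℓ″_0 = 0`, `ℓ′_1 = −2`, and the superadditivity `ℓ″_{i+j} ≥ ℓ″_i + ℓ′_j` (D″ ⊗ D′), one gets: the two top layers `ℓ″_{b−1} = 10 + c_0`,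
`ℓ′_{b−1} = 10 + c_{b−1}`, the penultimate `ℓ″_{b−2} = 12 + c_1`, the domination `c_j ≤ c_0`, and the SHARPENED superadditivity
`ℓ′_{i+j} ≥ ℓ′_i + ℓ′_j + (c_{i+j} − c_j)`. [specialisation + `linarith`] -/
theorem pg28_pairing_consequences (b : ℕ) (hb : 3 ≤ b) (lp lq c : ℕ → ℤ)
    (hpair : ∀ j k : ℕ, j + k + 1 = b → lp j + lq k = 10 + c j)
    (hp0 : lp 0 = 0) (hq0 : lq 0 = 0) (hp1 : lp 1 = -2)
    (hsup : ∀ i j : ℕ, i + j + 1 ≤ b → lq i + lp j ≤ lq (i + j)) :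
    lq (b - 1) = 10 + c 0 ∧ lp (b - 1) = 10 + c (b - 1) ∧ lq (b - 2) = 12 + c 1 ∧
    (∀ j : ℕ, j + 1 ≤ b → c j ≤ c 0) ∧
    (∀ i j : ℕ, i + j + 1 ≤ b → lp i + lp j + (c (i + j) - c j) ≤ lp (i + j)) := by
  refine ⟨?_, ?_, ?_, ?_, ?_⟩
  · have h := hpair 0 (b - 1) (by omega); linarith
  · have h := hpair (b - 1) 0 (by omega); linarith
  · have h := hpair 1 (b - 2) (by omega); linarith
  · intro j hj
    -- D″_{b-1} ≥ D″_{b-1-j} + D′_j, then the pairing at j and at 0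
    have h1 := hsup (b - 1 - j) j (by omega)
    have h2 := hpair j (b - 1 - j) (by omega)
    have h3 := hpair 0 (b - 1) (by omega)
    have h4 : b - 1 - j + j = b - 1 := by omega
    rw [h4] at h1
    linarith
  · intro i j hij
    -- D″_{b-1-j} ≥ D″_{b-1-j-i} + D′_i, then the pairing at j and at i + j
    have h1 := hsup (b - 1 - j - i) i (by omega)
    have h2 := hpair j (b - 1 - j) (by omega)
    have h3 := hpair (i + j) (b - 1 - j - i) (by omega)
    have h4 : b - 1 - j - i + i = b - 1 - j := by omega
    rw [h4] at h1
    linarith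

/-- **[XLI] 4.2 (COROLLARY FLAT — the 1-part of a balanced thick line is flat below the top).** (a) the socle inequality at `j = 2`,
`(ℓ′_{b−3} − ℓ′_2 − c_{b−3}) + L_2 ≤ ε₀`, together with the sharpened superadditivity `ℓ′_{b−3} ≥ ℓ′_2 + ℓ′_{b−5} + (c_{b−3} − c_2)`, gives
`ℓ′_{b−5} ≤ ε₀ + c_2 − L_2 ≤ ε₀ + c_2 + 6` (as `L_2 ≥ −6`); (b) the two-term instance `j = 3`: adding `(ℓ′_{b−4} − ℓ′_3 − c_{b−4}) + L_3` and
`ℓ′_{b−4} ≥ ℓ′_3 + ℓ′_{b−7} + (c_{b−4} − c_3)` gives `ℓ′_{b−5} + ℓ′_{b−7} ≤ ε₀ + c_2 + c_3 − L_2 − L_3`; (c) with plain superadditivity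
`ℓ′_{b−5} ≥ q·ℓ′_2 − 2` (`q = ⌊(b−5)/2⌋ ≥ 8` for `b ≥ 22`, the `−2` being `ℓ′_1`) one gets `8·ℓ′_2 ≤ ε₀ + c_2 + 8`. [`linarith`, `nlinarith`] -/
theorem pg28_flat_one_part :
    (∀ l2 l3' l5' c2 c3' L2 e : ℤ, l3' - l2 - c3' + L2 ≤ e → l2 + l5' + (c3' - c2) ≤ l3' → -6 ≤ L2 →
        l5' ≤ e + c2 - L2 ∧ l5' ≤ e + c2 + 6) ∧
    (∀ l2 l3 l3' l4' l5' l7' c2 c3 c3' c4' L2 L3 e : ℤ,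
        (l3' - l2 - c3' + L2) + (l4' - l3 - c4' + L3) ≤ e →
        l2 + l5' + (c3' - c2) ≤ l3' → l3 + l7' + (c4' - c3) ≤ l4' →
        l5' + l7' ≤ e + c2 + c3 - L2 - L3) ∧
    (∀ l2 l5' c2 e q : ℤ, 8 ≤ q → q * l2 - 2 ≤ l5' → l5' ≤ e + c2 + 6 → 0 ≤ l2 → 8 * l2 ≤ e + c2 + 8) := by
  refine ⟨fun l2 l3' l5' c2 c3' L2 e h1 h2 h3 => ⟨by linarith, by linarith⟩,
    fun l2 l3 l3' l4' l5' l7' c2 c3 c3' c4' L2 L3 e h1 h2 h3 => by linarith,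
    fun l2 l5' c2 e q hq h1 h2 h0 => by nlinarith⟩

/-- **[XLI] 3.3–3.5 (LEMMA TOP, LEMMA S-TRACE, LEMMA P-TRACE, remark NU-CAP).** (a) TOP: `ℓ″_{b−1} = 17 + C″` and `ℓ′_{b−1} = 17 + C′` (the
image of `Ξ_Γ ⊗ 𝒪_{2Γ_S}`, `deg Ξ_Γ = 17`, cokernels `C′, C″ ≥ 0` with `C′ + C″ ≤ 2Λ`) against `ℓ″_{b−1} = 10 + c_0`, `ℓ′_{b−1} = 10 + c_{b−1}`:
`c_0 = 7 + C″ ≥ 7`, `c_{b−1} = 7 + C′ ≥ 7`, `c_0 + c_{b−1} ≤ 14 + 2Λ`. (b) S-TRACE: `e^S(Y) = χ(F¹) − χ(𝒪_{Y″}(−S))` with `χ(F¹) = 8b + T + 2`,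
`χ(𝒪_{Y″}) = 8b + T − 18 − (c_0 + c_{b−1})`, twist `−2(2b − 2)`: `e^S(Y) = 4b + 16 + (c_0 + c_{b−1}) = 2m + 16 + (c_0 + c_{b−1})`. (c) P-TRACE
(`ν = 2`, off `z_i`): `e^P ≥ 4 + (ℓ″_{b−1} − 1) + (ℓ″_{b−2} − 1) − (c_0 − c_{b−1}) = 24 + c_1 + c_{b−1} ≤ 52`, so `c_1 + c_{b−1} ≤ 28` and, with
`c_{b−1} ≥ 7`, `c_1 ≤ 21`. (d) NU-CAP arithmetic: `k(8 − ε₀) ≤ 10 + c_0 + 2(b − 1 − 2k)` gives `k(12 − ε₀) ≤ 2b + 8 + c_0`. [`omega`, `ring`,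
`linarith`] -/
theorem pg28_top_traces :
    (∀ lq' lp' C' C'' c0 cb Λ : ℤ, lq' = 17 + C'' → lp' = 17 + C' → 0 ≤ C' → 0 ≤ C'' → C' + C'' ≤ 2 * Λ →
        lq' = 10 + c0 → lp' = 10 + cb → c0 = 7 + C'' ∧ cb = 7 + C' ∧ 7 ≤ c0 ∧ 7 ≤ cb ∧ c0 + cb ≤ 14 + 2 * Λ) ∧
    (∀ b T c : ℤ, (8 * b + T + 2) - ((8 * b + T - 18 - c) - 2 * (2 * b - 2)) = 4 * b + 16 + c ∧
        4 * b + 16 + c = 2 * (2 * b) + 16 + c) ∧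
    (∀ c0 c1 cb eP : ℤ, 4 + ((10 + c0) - 1) + ((12 + c1) - 1) - (c0 - cb) ≤ eP → eP ≤ 52 → 7 ≤ cb →
        c1 + cb ≤ 28 ∧ c1 ≤ 21) ∧
    (∀ k b c e : ℤ, k * (8 - e) ≤ 10 + c + 2 * (b - 1 - 2 * k) → k * (12 - e) ≤ 2 * b + 8 + c) := by
  refine ⟨fun lq' lp' C' C'' c0 cb Λ h1 h2 h3 h4 h5 h6 h7 => ⟨by omega, by omega, by omega, by omega, by omega⟩,
    fun b T c => ⟨by ring, by ring⟩, fun c0 c1 cb eP h1 h2 h3 => ⟨by omega, by omega⟩, fun k b c e h => ?_⟩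
  have hk : k * (12 - e) = k * (8 - e) + 4 * k := by ring
  linarith

/-- **[XLI] 3.6 (LEMMA TRACELESS-THICK, parity bookkeeping).** The socle of the punctual complete intersection `Z_w` at a Weierstrass point
`w ∉ T` is spanned by the image of `u^{−k}x̃^{b−1}t̄` (`k = k″_{b−1}(w)`), of character `(−1)^{k+b}`; tracelessness demands character `−1`, i.e.
`k + b` odd: `k ≡ b + 1 (mod 2)`. In particular for even `b` the multiplicity `k` is odd, hence positive. [`omega`] -/
theorem pg28_traceless_parity (k b : ℕ) (hodd : (k + b) % 2 = 1) :
    k % 2 = (b + 1) % 2 ∧ (b % 2 = 0 → 1 ≤ k) := by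
  refine ⟨by omega, fun hb => by omega⟩

/-- The alternating Lefschetz sums of PROPOSITION PROFILE: `A n := Σ_{i<n} 6·(−1)^{i+1} = −3 + 3·(−1)^n ∈ {−6, 0}`, in particular `A n ≤ 0`.
(These are the partial sums `Σ_{i=2}^{j} L_i` of the profile with `f′_i = 0`, `f″_i = 6`, re-indexed from `i = 2`.) [induction, `ring`] -/
theorem pg28_alternating_sum (n : ℕ) :
    (∑ i ∈ range n, (6 : ℤ) * (-1) ^ (i + 1)) = -3 + 3 * (-1) ^ n ∧
    (∑ i ∈ range n, (6 : ℤ) * (-1) ^ (i + 1)) ≤ 0 := by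
  have key : ∀ n : ℕ, (∑ i ∈ range n, (6 : ℤ) * (-1) ^ (i + 1)) = -3 + 3 * (-1) ^ n := by
    intro n
    induction n with
    | zero => simp
    | succ n ih => rw [sum_range_succ, ih, pow_succ]; ring
  refine ⟨key n, ?_⟩
  rw [key n]
  rcases neg_one_pow_eq_or ℤ n with h | h <;> rw [h] <;> norm_num

/-- **[XLI] 5.1 (PROPOSITION PROFILE — the counting census admits a solution for every `b ≥ 6`).** The explicit profile
`ℓ′ = (0, −2, 0, …, 0, 12, 10)`, `ℓ″ = (0, −2, 10, …, 10, 12, 10)` (indices `0 … b−1`, all `c_j = 0`, `τ = 0`) satisfies: the pairing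
`ℓ′_j + ℓ″_{b−1−j} = 10`; the normalisations `ℓ′_0 = ℓ″_0 = 0`, `ℓ′_1 = ℓ″_1 = −2` (`D′_1 = D″_1 = 0`); effectivity `ℓ′_j + 2j ≥ 0` and `ℓ′_j ≤ ℓ″_j`
(`D′_j ≤ D″_j`); both superadditivities `ℓ′_{i+j} ≥ ℓ′_i + ℓ′_j`, `ℓ″_{i+j} ≥ ℓ″_i + ℓ′_j`; and every socle term `10 − ℓ′_i − ℓ″_i` vanishes for
`2 ≤ i ≤ b − 3`, so the socle partial sums up to `b − 3` are the bare Lefschetz sums (`≤ 0` for `L ≡ 0` and for the alternating `∓6` of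
`pg28_alternating_sum`), and the later partial sums only decrease (terms `−14 + L_{b−2} ≤ −8`, `−10 + L_{b−1} ≤ −4`). Hence no inequality among THICK-PAIRING,
THICK-BUDGET (implied by the pairing), the superadditivities, effectivity, TOP, S-TRACE and P-TRACE with `c ≡ 0` and THICK-SOCLE excludes the balanced thick line for
any `b`: the closure, if any, is not in the counting. [case splits, `omega`] -/
theorem pg28_profile (b : ℕ) (hb : 6 ≤ b) :
    ∃ lp lq : ℕ → ℤ,
      (∀ j k : ℕ, j + k + 1 = b → lp j + lq k = 10) ∧
      lp 0 = 0 ∧ lq 0 = 0 ∧ lp 1 = -2 ∧ lq 1 = -2 ∧ lp (b - 1) = 10 ∧ lq (b - 1) = 10 ∧ lp (b - 2) = 12 ∧ lq (b - 2) = 12 ∧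
      (∀ j : ℕ, j + 1 ≤ b → 0 ≤ lp j + 2 * j ∧ lp j ≤ lq j) ∧
      (∀ i j : ℕ, i + j + 1 ≤ b → lp i + lp j ≤ lp (i + j)) ∧
      (∀ i j : ℕ, i + j + 1 ≤ b → lq i + lp j ≤ lq (i + j)) ∧
      (∀ i : ℕ, 2 ≤ i → i + 3 ≤ b → 10 - lp i - lq i = 0) ∧
      (∀ L : ℤ, L ≤ 6 → 10 - lp (b - 2) - lq (b - 2) + L ≤ -8 ∧ 10 - lp (b - 1) - lq (b - 1) + L ≤ -4) := by
  refine ⟨fun j => if j = 0 then 0 else if j = 1 then -2 else if j + 3 ≤ b then 0 else if j + 2 = b then 12 else 10,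
    fun j => if j = 0 then 0 else if j = 1 then -2 else if j + 3 ≤ b then 10 else if j + 2 = b then 12 else 10,
    ?_, ?_, ?_, ?_, ?_, ?_, ?_, ?_, ?_, ?_, ?_, ?_, ?_, ?_⟩
  · intro j k hjk
    simp only
    split_ifs <;> omega
  · simp
  · simp
  · simp
  · simp
  · simp only; split_ifs <;> omega
  · simp only; split_ifs <;> omega
  · simp only; split_ifs <;> omega
  · simp only; split_ifs <;> omega
  · intro j hj
    simp only
    constructor <;> split_ifs <;> omega
  · intro i j hij
    simp only
    split_ifs <;> omega
  · intro i j hij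
    simp only
    split_ifs <;> omega
  · intro i hi hib
    simp only
    split_ifs <;> omega
  · intro L hL
    simp only
    constructor <;> split_ifs <;> omega

set_option maxHeartbeats 400000 in
/-- **[XLI] 5.1 (PROPOSITION PROFILE, the form of record; ERRATUM to the docstring of `pg28_profile` above: its `c ≡ 0` profile is the `τ = 0` toy and
does NOT meet LEMMA TOP, which forces `c_0, c_{b−1} ≥ 7` — the statement proved there is unaffected; the profile of record is the `κ = 7` instance
below). The counting census admits a solution for every `b ≥ 6` and every constant crossing level `κ ≥ 0`.** The explicit profile `ℓ′ = (0, −2, 0, …, 0, 12 + κ, 10 + κ)`, `ℓ″ = (0, −2, 10 + κ, …, 10 + κ, 12 + κ, 10 + κ)` (indices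
`0 … b−1`; all `c_j = κ`, so `τ/2 = κb`) satisfies: the pairing `ℓ′_j + ℓ″_{b−1−j} = 10 + κ`; the normalisations `ℓ′_0 = ℓ″_0 = 0`,
`ℓ′_1 = ℓ″_1 = −2` (`D′_1 = D″_1 = 0`, so `h¹ = 0`); effectivity `ℓ′_j + 2j ≥ 0` and `ℓ′_j ≤ ℓ″_j` (`D′_j ≤ D″_j`); both superadditivities
`ℓ′_{i+j} ≥ ℓ′_i + ℓ′_j`, `ℓ″_{i+j} ≥ ℓ″_i + ℓ′_j` (the sharpened ones coincide with these for constant `c`); every socle term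
`10 − ℓ′_i − ℓ″_i = −κ ≤ 0` for `2 ≤ i ≤ b − 3`, so the socle partial sums up to `b − 3` are `−κ(j − 1)` plus the bare Lefschetz sums (`≤ 0` for
`L ≡ 0`, for the alternating `∓6` of `pg28_alternating_sum`, or for `L_i = ∓1`), and the last two terms are `≤ −8 − 2κ`, `≤ −4 − 2κ`. With
`κ = 7` this profile also meets LEMMA TOP (`c_0 = c_{b−1} = 7`, `C′ = C″ = 0`), P-TRACE (`24 + c_1 + c_{b−1} = 38 ≤ 52`) and `τ = 14b = 7m ≤ mΛ`
(`Λ ≥ 7`). Hence no inequality among THICK-PAIRING, THICK-BUDGET (implied by the pairing), the superadditivities, effectivity, TOP, S-TRACE,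
P-TRACE and THICK-SOCLE excludes the balanced thick line for any `b`: the closure, if any, is not in the counting. [case splits, `omega`] -/
theorem pg28_profile_kappa (b : ℕ) (hb : 6 ≤ b) (κ : ℤ) (hκ : 0 ≤ κ) :
    ∃ lp lq : ℕ → ℤ,
      (∀ j k : ℕ, j + k + 1 = b → lp j + lq k = 10 + κ) ∧
      lp 0 = 0 ∧ lq 0 = 0 ∧ lp 1 = -2 ∧ lq 1 = -2 ∧
      lp (b - 1) = 10 + κ ∧ lq (b - 1) = 10 + κ ∧ lp (b - 2) = 12 + κ ∧ lq (b - 2) = 12 + κ ∧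
      (∀ j : ℕ, j + 1 ≤ b → 0 ≤ lp j + 2 * j ∧ lp j ≤ lq j) ∧
      (∀ i j : ℕ, i + j + 1 ≤ b → lp i + lp j ≤ lp (i + j)) ∧
      (∀ i j : ℕ, i + j + 1 ≤ b → lq i + lp j ≤ lq (i + j)) ∧
      (∀ i : ℕ, 2 ≤ i → i + 3 ≤ b → 10 - lp i - lq i = -κ) ∧
      (∀ L : ℤ, L ≤ 6 → 10 - lp (b - 2) - lq (b - 2) + L ≤ -8 - 2 * κ ∧ 10 - lp (b - 1) - lq (b - 1) + L ≤ -4 - 2 * κ) := by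
  refine ⟨fun j => if j = 0 then 0 else if j = 1 then -2 else if j + 3 ≤ b then 0 else if j + 2 = b then 12 + κ else 10 + κ,
    fun j => if j = 0 then 0 else if j = 1 then -2 else if j + 3 ≤ b then 10 + κ else if j + 2 = b then 12 + κ else 10 + κ,
    ?_, ?_, ?_, ?_, ?_, ?_, ?_, ?_, ?_, ?_, ?_, ?_, ?_, ?_⟩
  · intro j k hjk
    simp only
    split_ifs <;> omega
  · simp
  · simp
  · simp
  · simp
  · simp only; split_ifs <;> omega
  · simp only; split_ifs <;> omega
  · simp only; split_ifs <;> omega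
  · simp only; split_ifs <;> omega
  · intro j hj
    simp only
    constructor <;> split_ifs <;> omega
  · intro i j hij
    simp only
    split_ifs <;> omega
  · intro i j hij
    simp only
    split_ifs <;> omega
  · intro i hi hib
    simp only
    split_ifs <;> omega
  · intro L hL
    simp only
    constructor <;> split_ifs <;> omega

end ProductGroundTwentyEight

end Summit.HodgeConjecture.HodgeConjecture.WeilTypeLadder
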